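import Mathlib
import Summits.ValiantsHypothesis.ValiantsHypothesis.Theses.FermionizationDimension
import Summits.ValiantsHypothesis.ValiantsHypothesis.Theorems.DetqpThesis.Negative.NotQPBoundedOfExp
import Summits.ValiantsHypothesis.ValiantsHypothesis.Theorems.ClassTransfer.Negative.FlatteningKernel

/-!
# Crux `ClassTransfer` (stmt-ValiantsHypothesis-7287): the route's cheapest falsifier made formal —
# realisations of the two-cycle weight need dimension `(n/2)!`, so `T ∈ VP ⇒ ¬ ClassTransfer`

Lead prover of line `registered` (= `Cruxes/ClassTransfer/Lines/birth.lean`), negative side of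
the crux `Summit.ValiantsHypothesis.ValiantsHypothesis.Theses.FermionizationDimension.ClassTransfer`
("every VP class-function family `χ_n` on `S_n` has commutative twisting realisations
`ℓ(∏_i u_{σ(i),i}) = sgn(σ) χ_n(σ)` of quasi-polynomial dimension").

The route header names its CHEAPEST FALSIFIER: the class-function family
`T_n(t) = Σ_σ sgn(σ) t^{c₂(σ)} x^σ` (`c₂` = number of 2-cycles) — "in VP ⇒ the crux is in acute
danger".  This file turns the danger into a theorem, for `t = 4`, written with
`N₂(σ) = #{x : σ²x = x, σx ≠ x} = 2 c₂(σ)` so that `t^{c₂} = 2^{N₂}`: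

* (tools, `Negative/FlatteningKernel.lean`) `card_le_finrank_of_flattening` — `ℓ(P α · Q β) = M α β`
  with `M` nonsingular forces `dim R ≥ #ι`; `eq_zero_of_coincidenceKernel_mulVec_eq_zero` — the
  coincidence kernel `K(α, γ) = 4^{#{i : α i = γ i}}` on `S_m` is nonsingular.
* `factorial_le_finrank_of_twoCycleWeight` — any commutative realisation of `σ ↦ 2^{N₂(σ)}` on
  `S_{m+m}` has dimension `≥ m!`: flatten along the two blocks with the block permutations
  `τ(α, γ) = (inl i ↦ inr (α i), inr j ↦ inl (γ⁻¹ j))`, whose 2-cycles are the coincidences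
  `α i = γ i` (`N₂(τ(α, γ)) = 2 #{i : α i = γ i}`), so the flattening matrix is `K`.
* `twoCycleWeight_isClassFunction` — `sgn(σ) 2^{N₂(σ)}` is a class function.
* `not_classTransfer_of_isVPFamily_twoCycleWeight` — **if the family
  `Σ_σ sgn(σ) 2^{N₂(σ)} x^σ` is in `VP` then `ClassTransfer` is false**: the crux would give a
  quasi-polynomially bounded `s` with `n! ≤ dim R ≤ s(2n) ≤ 2^{(log₂ 2n + c)^c} < n!` at the gap
  point of `exists_qpBound_double_lt_factorial`.

So on this family the crux stands or falls with ONE concrete upper-bound question — is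
`Σ_σ sgn(σ) 4^{c₂(σ)} ∏ x_{σ(i),i}` (by the matching expansion `4^{c₂} = Σ_{P ⊆ 2-cycles} 3^{|P|}`
this is `Σ_P (-3)^{|P|} x^P det X[V ∖ V(P)]` over partial matchings `P`, a digon-weighted
determinant sum) computable by polynomial-size arithmetic circuits? — exactly the planner's
recorded risk, with the lower-bound half now discharged.  The same flattening gives
`dim ≥ m!` on `S_{2m}` for the weight `t^{c₂}` for every real `t > 1` (kernel weights
`(t-1)^{|U|} > 0`); only `t = 4` is formalised.  No new definitions (the weight is written
inline, as the crux writes its class functions).  References: flattening / partial-derivative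
matrices as dimension lower bounds are folklore (Nisan 1991 for noncommutative branching
programs; here for commutative coefficient algebras); the kernel positivity is the Gram /
Schur-product argument. [folklore]
-/

set_option linter.dupNamespace false

noncomputable section

namespace Summit.ValiantsHypothesis.ValiantsHypothesis.Theorems.ClassTransfer.Negative

open Equiv Finset

/-! ## Flattening the two-cycle weight across two blocks -/

/-- **Block flattening of the two-cycle weight.**  If `(R, u, ℓ)` realises
`σ ↦ 2^{N₂(σ)}` on `S_{m+m}` (`N₂(σ) = #{x : σ²x = x, σx ≠ x}` = twice the number of 2-cycles),
then `dim R ≥ m!`: for `α, γ ∈ S_m` the block permutation `τ(α, γ)` (`inl i ↦ inr (α i)`,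
`inr j ↦ inl (γ⁻¹ j)`) has `N₂ = 2 · #{i : α i = γ i}`, its realising product splits as
`P α · Q γ`, and the coincidence kernel `4^{#{i : α i = γ i}}` is nonsingular
(`eq_zero_of_coincidenceKernel_mulVec_eq_zero`, `card_le_finrank_of_flattening`). [folklore] -/
theorem factorial_le_finrank_of_twoCycleWeight {m : ℕ} {R : Type*} [CommRing R] [Algebra ℂ R]
    [Module.Finite ℂ R] (u : Fin (m + m) → Fin (m + m) → R) (ℓ : R →ₗ[ℂ] ℂ)
    (hu : ∀ σ : Perm (Fin (m + m)), ℓ (∏ x, u (σ x) x) =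
      (2 : ℂ) ^ (univ.filter fun x : Fin (m + m) => σ (σ x) = x ∧ σ x ≠ x).card) :
    Nat.factorial m ≤ Module.finrank ℂ R := by
  set e : Fin m ⊕ Fin m ≃ Fin (m + m) := finSumFinEquiv with he
  set τ : Perm (Fin m) → Perm (Fin m) → Perm (Fin (m + m)) := fun α γ =>
    e.permCongr ((Equiv.sumCongr α γ.symm).trans (Equiv.sumComm (Fin m) (Fin m))) with hτ
  have hinl : ∀ (α γ : Perm (Fin m)) (i : Fin m), τ α γ (e (Sum.inl i)) = e (Sum.inr (α i)) := by
    intro α γ i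
    simp [hτ, Equiv.permCongr_apply]
  have hinr : ∀ (α γ : Perm (Fin m)) (j : Fin m),
      τ α γ (e (Sum.inr j)) = e (Sum.inl (γ.symm j)) := by
    intro α γ j
    simp [hτ, Equiv.permCongr_apply]
  set P : Perm (Fin m) → R := fun α => ∏ i : Fin m, u (e (Sum.inr (α i))) (e (Sum.inl i)) with hP
  set Q : Perm (Fin m) → R := fun γ => ∏ j : Fin m, u (e (Sum.inl (γ.symm j))) (e (Sum.inr j))
    with hQ
  -- the realising product splits along the two blocks
  have hprod : ∀ α γ : Perm (Fin m), ∏ x, u (τ α γ x) x = P α * Q γ := by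
    intro α γ
    rw [← Fintype.prod_equiv e (fun y => u (τ α γ (e y)) (e y)) (fun x => u (τ α γ x) x)
      (fun y => rfl), Fintype.prod_sum_type]
    simp only [hinl, hinr, hP, hQ]
  -- the two-cycle count of a block permutation
  have hcard : ∀ α γ : Perm (Fin m),
      (univ.filter fun x : Fin (m + m) => τ α γ (τ α γ x) = x ∧ τ α γ x ≠ x).card =
        2 * (univ.filter fun i : Fin m => α i = γ i).card := by
    intro α γ
    have hmap : (univ.filter fun x : Fin (m + m) => τ α γ (τ α γ x) = x ∧ τ α γ x ≠ x) =
        ((univ : Finset (Fin m ⊕ Fin m)).filter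
          (fun y => τ α γ (τ α γ (e y)) = e y ∧ τ α γ (e y) ≠ e y)).map e.toEmbedding := by
      rw [← Finset.map_univ_equiv e, Finset.filter_map]
      rfl
    rw [hmap, Finset.card_map, Finset.card_filter, Fintype.sum_sum_type]
    have hl : ∀ i : Fin m, (τ α γ (τ α γ (e (Sum.inl i))) = e (Sum.inl i) ∧
        τ α γ (e (Sum.inl i)) ≠ e (Sum.inl i)) ↔ α i = γ i := by
      intro i
      rw [hinl, hinr]
      constructor
      · rintro ⟨h1, -⟩
        have h2 : γ.symm (α i) = i := Sum.inl_injective (e.injective h1)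
        exact (Equiv.symm_apply_eq _).1 h2
      · intro h
        refine ⟨?_, fun h' => ?_⟩
        · rw [h]; simp
        · exact absurd (e.injective h') Sum.inr_ne_inl
    have hr : ∀ j : Fin m, (τ α γ (τ α γ (e (Sum.inr j))) = e (Sum.inr j) ∧
        τ α γ (e (Sum.inr j)) ≠ e (Sum.inr j)) ↔ α (γ.symm j) = j := by
      intro j
      rw [hinr, hinl]
      constructor
      · rintro ⟨h1, -⟩
        exact Sum.inr_injective (e.injective h1)
      · intro h
        refine ⟨?_, fun h' => ?_⟩
        · rw [h]
        · exact absurd (e.injective h') Sum.inl_ne_inr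
    rw [Finset.sum_congr rfl fun i _ => if_congr (hl i) rfl rfl,
      Finset.sum_congr rfl fun j _ => if_congr (hr j) rfl rfl,
      ← Fintype.sum_equiv γ (fun i => if α i = γ i then 1 else 0)
        (fun j => if α (γ.symm j) = j then 1 else 0) (fun i => by simp),
      ← Finset.card_filter, two_mul]
  -- the flattening matrix is the coincidence kernel
  have hM : ∀ α γ : Perm (Fin m),
      ℓ (P α * Q γ) = (4 : ℂ) ^ (univ.filter fun i : Fin m => α i = γ i).card := by
    intro α γ
    rw [← hprod, hu, hcard, pow_mul]
    norm_num
  calc Nat.factorial m = Fintype.card (Perm (Fin m)) := by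
        rw [Fintype.card_perm, Fintype.card_fin]
    _ ≤ Module.finrank ℂ R :=
        card_le_finrank_of_flattening ℓ P Q
          (Matrix.of fun α γ : Perm (Fin m) =>
            (4 : ℂ) ^ (univ.filter fun i : Fin m => α i = γ i).card)
          (fun α γ => by rw [Matrix.of_apply]; exact hM α γ)
          (fun v hv => eq_zero_of_coincidenceKernel_mulVec_eq_zero v fun α => by
            simpa only [Matrix.mulVec, dotProduct, Matrix.of_apply, Pi.zero_apply]
              using congrFun hv α)

/-! ## The two-cycle weight is a class function -/

/-- `N₂(σ) = #{x : σ²x = x, σx ≠ x}` (the number of points on 2-cycles) is invariant under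
conjugation. [folklore] -/
theorem card_twoCyclePoints_conj {n : ℕ} (c σ : Perm (Fin n)) :
    (univ.filter fun x : Fin n =>
        (c * σ * c⁻¹) ((c * σ * c⁻¹) x) = x ∧ (c * σ * c⁻¹) x ≠ x).card =
      (univ.filter fun x : Fin n => σ (σ x) = x ∧ σ x ≠ x).card := by
  have hmap : (univ.filter fun x : Fin n =>
      (c * σ * c⁻¹) ((c * σ * c⁻¹) x) = x ∧ (c * σ * c⁻¹) x ≠ x) =
      ((univ : Finset (Fin n)).filter
        (fun y => (c * σ * c⁻¹) ((c * σ * c⁻¹) (c y)) = c y ∧ (c * σ * c⁻¹) (c y) ≠ c y)).map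
          (Equiv.toEmbedding c) := by
    conv_lhs => rw [← Finset.map_univ_equiv c, Finset.filter_map]
    rfl
  rw [hmap, Finset.card_map]
  congr 1
  refine Finset.filter_congr fun y _ => ?_
  simp only [Perm.mul_apply, Perm.coe_inv, Equiv.symm_apply_apply]
  constructor
  · rintro ⟨h1, h2⟩
    exact ⟨c.injective h1, fun h => h2 (by rw [h])⟩
  · rintro ⟨h1, h2⟩
    exact ⟨by rw [h1], fun h => h2 (c.injective h)⟩

/-- The signed two-cycle weight `χ(σ) = sgn(σ) · 2^{N₂(σ)}` is a class function on every `S_n`.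
[folklore] -/
theorem twoCycleWeight_isClassFunction (n : ℕ) (σ ρ : Perm (Fin n)) (h : IsConj σ ρ) :
    ((Perm.sign σ : ℤ) : ℂ) *
        (2 : ℂ) ^ (univ.filter fun x : Fin n => σ (σ x) = x ∧ σ x ≠ x).card =
      ((Perm.sign ρ : ℤ) : ℂ) *
        (2 : ℂ) ^ (univ.filter fun x : Fin n => ρ (ρ x) = x ∧ ρ x ≠ x).card := by
  obtain ⟨c, rfl⟩ := isConj_iff.1 h
  rw [card_twoCyclePoints_conj c σ]
  congr 2
  rw [Perm.sign_mul, Perm.sign_mul, Perm.sign_inv]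
  rw [mul_comm (Perm.sign c) (Perm.sign σ), mul_assoc, Int.units_mul_self, mul_one]

/-! ## `T ∈ VP ⇒ ¬ ClassTransfer` -/

/-- Arithmetic for the endgame: some `n ≥ 1` has `2^{(log₂(n+n) + c)^c} < n!`. [folklore] -/
theorem exists_qpBound_double_lt_factorial (c : ℕ) :
    ∃ n : ℕ, 1 ≤ n ∧ 2 ^ ((Nat.log 2 (n + n) + c) ^ c) < Nat.factorial n := by
  obtain ⟨n, hn4, -, hle⟩ :=
    Summit.ValiantsHypothesis.Theorems.DetqpThesis.Negative.exists_ge_qpExp_le (c + 1) 4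
  refine ⟨n, by omega, ?_⟩
  have hlog : Nat.log 2 (n + n) = Nat.log 2 n + 1 := by
    rw [← mul_two, Nat.log_mul_base Nat.one_lt_two (by omega)]
  set B := Nat.log 2 n + c + 1 with hB
  have hB' : Nat.log 2 n + (c + 1) = B := by omega
  have hlog1 : 0 < Nat.log 2 n := Nat.log_pos Nat.one_lt_two (by omega)
  have hB2 : 2 ≤ B := by omega
  rw [hB', pow_succ] at hle
  have hBc : B ^ c * 2 ≤ B ^ c * B := Nat.mul_le_mul_left _ hB2
  have hexp : (Nat.log 2 (n + n) + c) ^ c ≤ n - 2 := by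
    rw [hlog, show Nat.log 2 n + 1 + c = B by omega]
    omega
  have hfac : 2 ^ (n - 1) ≤ Nat.factorial n := by
    have := @Nat.factorial_mul_pow_le_factorial 1 (n - 1)
    rw [Nat.factorial_one, one_mul, show 1 + (n - 1) = n by omega] at this
    simpa using this
  calc 2 ^ ((Nat.log 2 (n + n) + c) ^ c) ≤ 2 ^ (n - 2) := Nat.pow_le_pow_right (by norm_num) hexp
    _ < 2 ^ (n - 1) := Nat.pow_lt_pow_right (by norm_num) (by omega)
    _ ≤ Nat.factorial n := hfac

/-- **No quasi-polynomial commutative realisation of the two-cycle weight.**  There is no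
quasi-polynomially bounded `s` such that every `S_n` carries a commutative realisation
`ℓ(∏_i u_{σ(i),i}) = sgn(σ) · (sgn(σ) 2^{N₂(σ)})` (`= 2^{N₂(σ)}`) of dimension `≤ s(n)`: at size
`n + n` the dimension is `≥ n!` (`factorial_le_finrank_of_twoCycleWeight`), which beats the bound at
the gap point of `exists_qpBound_double_lt_factorial`.  (The realisation clause is the crux's,
verbatim, at the class function `χ(σ) = sgn(σ) 2^{N₂(σ)}`.) [folklore] -/
theorem not_qpRealisable_twoCycleWeight :
    ¬ ∃ s : ℕ → ℕ, Literature.Computability.AlgebraicComplexity.IsQPBounded s ∧ ∀ n : ℕ,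
      ∃ (R : Type) (_ : CommRing R) (_ : Algebra ℂ R) (_ : Module.Finite ℂ R)
        (u : Fin n → Fin n → R) (ℓ : R →ₗ[ℂ] ℂ), Module.finrank ℂ R ≤ s n ∧
        ∀ σ : Equiv.Perm (Fin n), ℓ (∏ i, u (σ i) i) =
          ((Equiv.Perm.sign σ : ℤ) : ℂ) * (((Equiv.Perm.sign σ : ℤ) : ℂ) *
            (2 : ℂ) ^ (univ.filter fun x : Fin n => σ (σ x) = x ∧ σ x ≠ x).card) := by
  rintro ⟨s, ⟨c, hc⟩, hreal⟩
  obtain ⟨n, -, hlt⟩ := exists_qpBound_double_lt_factorial c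
  obtain ⟨R, _, _, _, u, ℓ, hdim, hu⟩ := hreal (n + n)
  have hu' : ∀ σ : Perm (Fin (n + n)), ℓ (∏ x, u (σ x) x) =
      (2 : ℂ) ^ (univ.filter fun x : Fin (n + n) => σ (σ x) = x ∧ σ x ≠ x).card := by
    intro σ
    rw [hu σ, ← mul_assoc, ← Int.cast_mul, ← Units.val_mul, Int.units_mul_self]
    simp
  have hflat := factorial_le_finrank_of_twoCycleWeight u ℓ hu'
  have hs := hc (n + n)
  omega

/-- **The route's cheapest falsifier, formally**: if the class-function family
`T_n = Σ_σ sgn(σ) 2^{N₂(σ)} x^σ` (`N₂` = number of points on 2-cycles; this is the route header's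
`Σ sgn(σ) t^{c₂(σ)} x^σ` at `t = 4`) is in `VP`, then `ClassTransfer` is false
(`not_qpRealisable_twoCycleWeight` at the class function `sgn · 2^{N₂}`,
`twoCycleWeight_isClassFunction`). [folklore] -/
theorem not_classTransfer_of_isVPFamily_twoCycleWeight
    (hVP : Literature.Computability.AlgebraicComplexity.IsVPFamily
      (fun n => ∑ σ : Equiv.Perm (Fin n),
        MvPolynomial.C (((Equiv.Perm.sign σ : ℤ) : ℂ) *
            (2 : ℂ) ^ (univ.filter fun x : Fin n => σ (σ x) = x ∧ σ x ≠ x).card) *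
          ∏ i : Fin n, MvPolynomial.X (σ i, i))) :
    ¬ Summit.ValiantsHypothesis.ValiantsHypothesis.Theses.FermionizationDimension.ClassTransfer :=
  fun hCT => not_qpRealisable_twoCycleWeight (hCT
    (fun n σ => ((Equiv.Perm.sign σ : ℤ) : ℂ) *
      (2 : ℂ) ^ (univ.filter fun x : Fin n => σ (σ x) = x ∧ σ x ≠ x).card)
    twoCycleWeight_isClassFunction hVP)

/-- **Tightness: the `VP` hypothesis of `ClassTransfer` is load-bearing.**  Dropping
`IsVPFamily` from the crux makes it false outright — the class function `sgn · 2^{N₂}` has no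
quasi-polynomial commutative realisation (`not_qpRealisable_twoCycleWeight`), whatever the
circuit complexity of its generalized matrix functions. [folklore] -/
theorem classTransfer_false_without_isVPFamily :
    ¬ ∀ χ : (n : ℕ) → Equiv.Perm (Fin n) → ℂ,
      (∀ n (σ τ : Equiv.Perm (Fin n)), IsConj σ τ → χ n σ = χ n τ) →
      ∃ s : ℕ → ℕ, Literature.Computability.AlgebraicComplexity.IsQPBounded s ∧ ∀ n : ℕ,
        ∃ (R : Type) (_ : CommRing R) (_ : Algebra ℂ R) (_ : Module.Finite ℂ R)
          (u : Fin n → Fin n → R) (ℓ : R →ₗ[ℂ] ℂ), Module.finrank ℂ R ≤ s n ∧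
          ∀ σ : Equiv.Perm (Fin n), ℓ (∏ i, u (σ i) i) =
            ((Equiv.Perm.sign σ : ℤ) : ℂ) * χ n σ :=
  fun h => not_qpRealisable_twoCycleWeight (h
    (fun n σ => ((Equiv.Perm.sign σ : ℤ) : ℂ) *
      (2 : ℂ) ^ (univ.filter fun x : Fin n => σ (σ x) = x ∧ σ x ≠ x).card)
    twoCycleWeight_isClassFunction)

end Summit.ValiantsHypothesis.ValiantsHypothesis.Theorems.ClassTransfer.Negative
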